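import Summits.QuantumFields.BalabanUV.T4Continuum.Support.VariationalVectorRegularityRho

/-!
# T⁴ programme, spine node NE2 (U1a), lane P2 — leaf V-REG (1-forms), file 4/4: THE VECTOR END (Feynman–Landau family `G k = landauG 1 (R k)`) WITH
# LEAF V-REG DISCHARGED — `VariationalVectorLandauTower.towerLimitRate_effV_of_leaves_landau` (leaf-10-g3, p220989) at `δ = 1` with its `hREG k` binder
# REPLACED by file 3/4's `hREG_rhoV_landau` at `ρV k := rhoV (L^k) M (R k)`: the remaining displayed families are V-UB, V-P, V-FED, V-ONE, (Går), plus the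
# plaquette class `(L^k)²·p_k ≤ c_pl` and contractive line transports (cell `pub-balaban`, NE2 formalisation swarm, leaf prover 03 gen 5)

HONEST FRAMING (T4-DAG p. 1).  Rung (B)+1 only — NOT infinite volume, NOT a mass gap, NOT Clay.  NE2 is NOT IN PRINT and NOT proved here.  MODEL LEVEL,
`E = ℂ`: transports `R k`, `R′ k`, `T k`, `T′ k` DATA (unitary bonds with plaquette defects `p k`, contractive line transports); the Landau functional is the
tree's only typed inhabitant of the gauge term and is NOT offered as Bałaban's `G` ([B9] (3.26)); the displayed `hFED`∕`hONE` for `landauG` are NOT expected as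
displayed for the naive Landau functional under the line average (NOTE N-ne2leaf01g6-1, leaf-09-g6's located remark in p219068) — V-GF OPEN.  What is proved is
bookkeeping ([folklore]): the starred constant `CRs := 4Λs + 2d·c_pl·(CGars + CGars′) + 5d²·c_pl²·CPs` dominates file 3/4's per-level `C_R k`.  No `def`, no
`sorry`, axioms standard.  NE2 NOT proved; NE3 OPEN; spine PROVED 0∕9.  HONEST DEPENDENCY (cell, verbatim): continuum YM on T⁴ ⇐ BetaPertH ∧ nine spine
estimates (0/9 proved); BetaPertH ⇐ (D1) ∧ (D4) ∧ CAP+tail; G-an2-4 gates asym, D1 and NE2/3/4.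
-/

noncomputable section

open scoped BigOperators ComplexConjugate ComplexOrder Matrix

namespace Summit.QuantumFields.BalabanUV.T4Continuum.VariationalVectorEndOfLeavesReg

open Finset
open Literature.MathematicalPhysics.QuantumFieldTheory.Balaban1983to89.B5Prop11Plancherel (Tor fine unitVec)
open Summit.QuantumFields.BalabanUV.T4Continuum.VariationalTransfer (blockSpin)
open Summit.QuantumFields.BalabanUV.T4Continuum.VariationalColourTower (Rtrv)
open Summit.QuantumFields.BalabanUV.T4Continuum.CovariantAveragingTower (TowerLimitRate)
open Summit.QuantumFields.BalabanUV.T4Continuum.VectorBlockTrialForm (nsqV nsqV_nonneg QvL compL roughV)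
open Summit.QuantumFields.BalabanUV.T4Continuum.VariationalVectorForm (ScV SfV qWV qVV)
open Summit.QuantumFields.BalabanUV.T4Continuum.VariationalVectorEffective (effV)
open Summit.QuantumFields.BalabanUV.T4Continuum.VariationalVectorTower (QmL)
open Summit.QuantumFields.BalabanUV.T4Continuum.VariationalVectorGarding (landauG)
open Summit.QuantumFields.BalabanUV.T4Continuum.VariationalVectorLandauTower (KLandau towerLimitRate_effV_of_leaves_landau)
open Summit.QuantumFields.BalabanUV.T4Continuum.VariationalVectorEndOfLeaves (eV ePV)
open Summit.QuantumFields.BalabanUV.T4Continuum.VariationalVectorOneStepPhys (rhoV rhoV_nonneg)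
open Summit.QuantumFields.BalabanUV.T4Continuum.VariationalVectorRegularityRho (hREG_rhoV_landau)

variable {d : ℕ} (L : ℕ) [NeZero L] (M : Fin d → ℕ) [hM : ∀ μ, NeZero (M μ)]
variable (R : (k : ℕ) → Tor (fine (L ^ k) M) → Fin d → (ℂ →L[ℂ] ℂ))
variable (R' : (k : ℕ) → Tor (fine L (fine (L ^ k) M)) → Fin d → (ℂ →L[ℂ] ℂ))
variable (T : (k : ℕ) → Tor M → (Fin d → Fin (L ^ k)) → Fin (L ^ k) → Fin d → (ℂ →L[ℂ] ℂ))
variable (T' : (k : ℕ) → Tor (fine (L ^ k) M) → (Fin d → Fin L) → Fin L → Fin d → (ℂ →L[ℂ] ℂ))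

omit [NeZero L] in
/-- the per-level V-REG constant of file 3 (`hREG_rhoV_landau`) is dominated by the starred constant in the plaquette class `(L^k)²·p_k ≤ c_pl`. [folklore] -/
theorem CR_level_le {Λ CP CGar CGar' p : ℕ → ℝ} {Λs CPs CGars CGars' cpl : ℝ}
    (hΛs : ∀ k, Λ k ≤ Λs) (hCP : ∀ k, 0 ≤ CP k) (hCPs : ∀ k, CP k ≤ CPs) (hCGar : ∀ k, 0 ≤ CGar k) (hCGars : ∀ k, CGar k ≤ CGars)
    (hCGar' : ∀ k, 0 ≤ CGar' k) (hCGars' : ∀ k, CGar' k ≤ CGars') (hp : ∀ k, 0 ≤ p k) (hpl : ∀ k, ((L : ℝ) ^ k) ^ 2 * p k ≤ cpl) (k : ℕ) :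
    4 * Λ k + 2 * d * ((((L ^ k : ℕ) : ℝ)) ^ 2 * p k) * (CGar k + CGar' k) + 5 * (d : ℝ) ^ 2 * ((((L ^ k : ℕ) : ℝ)) ^ 2 * p k) ^ 2 * CP k
      ≤ 4 * Λs + 2 * d * cpl * (CGars + CGars') + 5 * (d : ℝ) ^ 2 * cpl ^ 2 * CPs := by
  have hd : (0 : ℝ) ≤ d := Nat.cast_nonneg d
  have hpk : 0 ≤ p k := hp k
  set α : ℝ := (((L ^ k : ℕ) : ℝ)) ^ 2 * p k with hα
  have hα0 : 0 ≤ α := by rw [hα]; positivity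
  have hαc : α ≤ cpl := by rw [hα]; push_cast; exact hpl k
  have hcpl : 0 ≤ cpl := hα0.trans hαc
  have h1 : 2 * d * α * (CGar k + CGar' k) ≤ 2 * d * cpl * (CGars + CGars') :=
    mul_le_mul (by nlinarith) (add_le_add (hCGars k) (hCGars' k)) (add_nonneg (hCGar k) (hCGar' k)) (by positivity)
  have h2 : 5 * (d : ℝ) ^ 2 * α ^ 2 * CP k ≤ 5 * (d : ℝ) ^ 2 * cpl ^ 2 * CPs :=
    mul_le_mul (by nlinarith [pow_le_pow_left₀ hα0 hαc 2]) (hCPs k) (hCP k) (by positivity)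
  linarith [hΛs k]

/-- **THE VECTOR END OF ROAD P2, FEYNMAN–LANDAU FAMILY `G k = landauG 1 (R k)`, WITH LEAF V-REG DISCHARGED** (model level, `E = ℂ`): leaf-10-g3's
`towerLimitRate_effV_of_leaves_landau` at `δ = 1` and `ρV k := rhoV (L^k) M (R k)` (V-ONE-1F's functional), its `hREG k` binder SUPPLIED by file 3/4's
`hREG_rhoV_landau`.  In its place: UNITARY bond transports `R k` with operator plaquette defects `≤ p k` in the class `(L^k)²·p_k ≤ c_pl`, CONTRACTIVE line
transports `T k`, and the Gårding inequality (Går) per level (`CGar k ≤ CGars`, `CGar′ k ≤ CGars′`; leaf-09-g6's `garding_landau` shape).  The starred V-REG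
constant is `CRs := 4Λs + 2d·c_pl·(CGars + CGars′) + 5d²·c_pl²·CPs`.  Remaining displayed leaf families: V-UB (both levels), V-P (both levels), V-FED, V-ONE,
(Går).  HONEST: see the module docstring (Landau is a model inhabitant; V-GF OPEN; NE2 NOT proved; nothing of NE3). [folklore] -/
theorem towerLimitRate_effV_of_leaves_landau_reg
    (hTcomp : ∀ k, T (k + 1) = compL (L ^ k) L M (T k) (T' k)) (hRtr : ∀ k, R (k + 1) = Rtrv (L ^ k) L M (R' k))
    (hsurj₁ : ∀ k, Function.Surjective (QvL L (fine (L ^ k) M) (T' k)))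
    -- bond transports unitary with plaquette defects in the class `(L^k)²·p_k ≤ c_pl`; line transports contractive
    (hU : ∀ k x μ, R k x μ ∈ unitary (ℂ →L[ℂ] ℂ)) (p : ℕ → ℝ) (hp : ∀ k, 0 ≤ p k)
    (hP : ∀ k x μ ν, ‖R k x μ * R k (x + unitVec (fine (L ^ k) M) μ) ν - R k x ν * R k (x + unitVec (fine (L ^ k) M) ν) μ‖ ≤ p k)
    {cpl : ℝ} (hpl : ∀ k, ((L : ℝ) ^ k) ^ 2 * p k ≤ cpl) (hT1 : ∀ k y j t μ, ‖T k y j t μ‖ ≤ 1)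
    {a : ℝ} (ha : 0 < a)
    (Λ CP CGar CGar' δF ε₁ δ' : ℕ → ℝ) {Λs CPs CGars CGars' cδ cε cδ' θ : ℝ}
    (hΛ : ∀ k, 0 ≤ Λ k) (hΛs : ∀ k, Λ k ≤ Λs) (hCP : ∀ k, 0 ≤ CP k) (hCPs : ∀ k, CP k ≤ CPs)
    (hCGar : ∀ k, 0 ≤ CGar k) (hCGars : ∀ k, CGar k ≤ CGars) (hCGar' : ∀ k, 0 ≤ CGar' k) (hCGars' : ∀ k, CGar' k ≤ CGars')
    (hδF : ∀ k, 0 ≤ δF k) (hε₁ : ∀ k, 0 ≤ ε₁ k) (hδ' : ∀ k, 0 ≤ δ' k) (hθ : 0 ≤ θ) (hθ1 : θ < 1)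
    (hδθ : ∀ k, δF k ≤ cδ * θ ^ k) (hεθ : ∀ k, ε₁ k ≤ cε * θ ^ k) (hδ'θ : ∀ k, δ' k ≤ cδ' * θ ^ k)
    -- leaf V-UB at both levels, leaf V-P at both levels
    (hUBc : ∀ k (φ : Tor M → Fin d → ℂ), ∃ W, QvL (L ^ k) M (T k) W = φ ∧
      ScV (L ^ k) M (R k) (landauG (fine (L ^ k) M) 1 (R k)) W ≤ Λ k * nsqV M φ)
    (hUBf : ∀ k (φ : Tor M → Fin d → ℂ), ∃ W', QvL (L ^ k) M (T k) (QvL L (fine (L ^ k) M) (T' k) W') = φ ∧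
      SfV (L ^ k) L M (R' k) (landauG (fine L (fine (L ^ k) M)) 1 (R' k)) W' ≤ Λ k * nsqV M φ)
    (hPc : ∀ k W, qWV (L ^ k) M W ≤ CP k * (ScV (L ^ k) M (R k) (landauG (fine (L ^ k) M) 1 (R k)) W + nsqV M (QvL (L ^ k) M (T k) W)))
    (hPf : ∀ k W', qVV (L ^ k) L M W' ≤ CP k * (SfV (L ^ k) L M (R' k) (landauG (fine L (fine (L ^ k) M)) 1 (R' k)) W'
      + nsqV M (QvL (L ^ k) M (T k) (QvL L (fine (L ^ k) M) (T' k) W'))))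
    -- (Går) per level
    (hGar : ∀ k W, (((((L ^ k : ℕ) : ℝ)) ^ d)⁻¹ * ((((L ^ k : ℕ) : ℝ)) ^ 2 * roughV (L ^ k) M (R k) W))
      ≤ CGar k * ScV (L ^ k) M (R k) (landauG (fine (L ^ k) M) 1 (R k)) W + CGar' k * nsqV M (QvL (L ^ k) M (T k) W))
    -- leaf V-FED and leaf V-ONE (square-root shape, `ρV := rhoV`)
    (hFED : ∀ k W', ScV (L ^ k) M (R k) (landauG (fine (L ^ k) M) 1 (R k)) (QvL L (fine (L ^ k) M) (T' k) W')
      ≤ (Real.sqrt (SfV (L ^ k) L M (R' k) (landauG (fine L (fine (L ^ k) M)) 1 (R' k)) W') + δF k * Real.sqrt (qVV (L ^ k) L M W')) ^ 2)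
    (hONE : ∀ k W, blockSpin (QvL L (fine (L ^ k) M) (T' k)) (SfV (L ^ k) L M (R' k) (landauG (fine L (fine (L ^ k) M)) 1 (R' k))) W
      ≤ (Real.sqrt (ScV (L ^ k) M (R k) (landauG (fine (L ^ k) M) 1 (R k)) W + ε₁ k * rhoV (L ^ k) M (R k) W)
        + δ' k * Real.sqrt (qWV (L ^ k) M W)) ^ 2) :
    TowerLimitRate (ι := fun _ => Tor M × Fin d) (fun _ => (1 : Matrix (Tor M × Fin d) (Tor M × Fin d) ℂ)) 1
      (fun k => effV (L ^ k) M (R k) (KLandau (fine (L ^ k) M) 1 (R k)) (QmL (L ^ k) M (T k)) a)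
      (eV Λs CPs cδ + ePV Λs CPs (4 * Λs + 2 * d * cpl * (CGars + CGars') + 5 * (d : ℝ) ^ 2 * cpl ^ 2 * CPs) cε cδ') θ := by
  -- the per-level V-REG constant and its nonnegativity / uniform bound
  set CR : ℕ → ℝ := fun k => 4 * Λ k + 2 * d * ((((L ^ k : ℕ) : ℝ)) ^ 2 * p k) * (CGar k + CGar' k)
    + 5 * (d : ℝ) ^ 2 * ((((L ^ k : ℕ) : ℝ)) ^ 2 * p k) ^ 2 * CP k with hCRdef
  have hd : (0 : ℝ) ≤ d := Nat.cast_nonneg d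
  have hCR0 : ∀ k, 0 ≤ CR k := fun k => by
    have := hΛ k; have := hCP k; have := hCGar k; have := hCGar' k; have := hp k
    simp only [hCRdef]; positivity
  have hCRs : ∀ k, CR k ≤ 4 * Λs + 2 * d * cpl * (CGars + CGars') + 5 * (d : ℝ) ^ 2 * cpl ^ 2 * CPs := fun k =>
    CR_level_le L hΛs hCP hCPs hCGar hCGars hCGar' hCGars' hp hpl k
  refine towerLimitRate_effV_of_leaves_landau L M R R' T T' one_pos hTcomp hRtr hsurj₁ ha Λ CP CR δF ε₁ δ' hΛ hΛs hCP hCPs hCR0 hCRs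
    hδF hε₁ hδ' hθ hθ1 hδθ hεθ hδ'θ (fun k W => rhoV_nonneg (L ^ k) M (R k) W) hUBc hUBf hPc hPf hFED hONE ?_
  -- the `hREG k` binder from file 3
  intro k φ W hW hmin
  exact hREG_rhoV_landau (L ^ k) M (hU k) (hp k) (hP k) (hT1 k) (hΛ k) (hCGar k) (hCGar' k) (hUBc k) (hPc k) (hGar k) φ W hW hmin

end Summit.QuantumFields.BalabanUV.T4Continuum.VariationalVectorEndOfLeavesReg

end
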